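import Literature.Barriers.CriticalPhenomena.PlaquetteWalkHoleRootInitialRun
import HarnessLib

/-!
# The first turn of a wound walk from a hole root; slanted end at limit cost `5` without double visits

`Z → ∞` limit model of the printed Yang–Baxter weights (Glazman–Manolescu 2019, §1, eq. (1); the «RECTANGLE COEFFICIENT» line of
`PlaquetteWalkAngleLimitCoefficient(Wound)`, `PlaquetteWalkHoleRootWoundCost`, `PlaquetteWalkHoleRootExtremeRunShape`,
`PlaquetteWalkHoleRootInitialRun`).  A class-`B2a` walk `ω` from the hole root `a = w.side W` (hole plaquette `(w.1 − 1, w.2)` absent)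
that WINDS around the hole (`A_J(mid a) ≠ 0`) starts with a straight run EAST along the hole row (`YBWalk.initial_run`); this file
isolates its FIRST TURN and draws the consequence for the end side at limit cost `5`:

* ★ `ΩG.exists_first_turn_of_wound`: a wound class-`B2a` walk of limit cost `5` has a first non-straight arc `k` (all earlier arcs
  straight) — a walk with only straight arcs stays in the hole row, while the top row of a cost-`5` wound walk lies strictly above it
  (`turn_profile_of_cost_five`);
* ★★★ `ΩG.end_slanted_of_first_turn_single_cost_five`: if the plaquette of that first turn is SINGLY visited, the walk ends on the `N` or
  the `S` side of `r` — the first-turn plaquette `(w.1 + k, w.2)` is then an isolated turn in the hole row, strictly between the extreme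
  rows, and `turn_profile_of_cost_five` allows an isolated middle turn only for a slanted end (slot degree `1`);
* ★★★ `ΩG.end_slanted_of_injective_cost_five`: in particular a cost-`5` wound class-`B2a` walk WITHOUT DOUBLY VISITED PLAQUETTES
  (`fc` injective) ends on a slanted side of `r`, wherever `r` is.

With `PlaquetteWalkHoleRootInitialRun.end_slanted_of_initial_run_cost_five` (straight approach reaching a root-row `r`) this reduces the
lane's «slanted-end lemma» (every cost-`5` wound class-`B2a` member has slot `N` or `S`; exact census kit j276221: all 2 563 root-row
cells) to the absence of doubly visited plaquettes at cost `5` (census: `n_{w₁} = n_{w₂} = 0` for every class-`B2a` member).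
[GlazmanManolescu2019 §1 Fig. 1, eq. (1), Lemma 2.1, Remark 2.2; Glazman 2015 Lemma 3.1 (proof, pp. 6–7)]
-/

noncomputable section

namespace Literature.Probability.RandomPlanarGeometry.SAW.YangBaxter

open Real
open Literature.Barriers.CriticalPhenomena.PlaquetteWalk

namespace ΩG

variable {D : Set Face} {w r : Face} {ω : ΩG D (w.side .W) r}

/-- ★ **THE FIRST TURN EXISTS**: a wound class-`B2a` walk of limit cost `5` from the hole root has a first non-straight arc — an index `k`
with all earlier arcs straight and the `k`-th arc a turn.  (If every arc were straight the walk would run east along the hole row for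
ever (`YBWalk.initial_run`), but its top row lies strictly above the hole row.)
[cite: GlazmanManolescu2019, §1, Fig. 1 and Lemma 2.1] [cite: Glazman2015WeightedSAW, Lemma 3.1 (proof, pp. 6–7)] -/
theorem exists_first_turn_of_wound (hh : holeFaceW w ∉ D) (hr : RootedFace D (w.side .W) r) (h : ω.IsB2a)
    (hA : ω.AJ hr h (toC (midPt (w.side .W))) ≠ 0) (hc : cost (slotOfSide ω.1) ω.2.mids = 5) :
    ∃ k, k < ω.2.arcs.length ∧ (∀ i < k, arcKind (ω.2.sIn i) (ω.2.sOut i) = .straight) ∧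
      arcKind (ω.2.sIn k) (ω.2.sOut k) ≠ .straight := by
  classical
  by_contra hne
  push Not at hne
  -- then every arc is straight
  have hall : ∀ i, i < ω.2.arcs.length → arcKind (ω.2.sIn i) (ω.2.sOut i) = .straight := by
    intro i
    induction i using Nat.strong_induction_on with
    | _ i ih => exact fun hi => hne i hi (fun j hj => ih j hj (by omega))
  -- the top row `Y > w.2` carries a visited plaquette, but all plaquettes lie in the hole row
  obtain ⟨Y, Y', -, hYw, -, -, -, T₁, T₂, hT₁, -, hr₁, -, hc₁, -⟩ := turn_profile_of_cost_five hh hr h hA hc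
  obtain ⟨f, hf⟩ := Finset.card_pos.1 (by omega : 0 < T₁.card)
  obtain ⟨m, hm, hfm⟩ := ω.2.exists_fc_eq_of_mem_facesL (hT₁ f hf).1
  obtain ⟨hrun, -⟩ := ω.2.initial_run hh (show ω.2.arcs.length - 1 < ω.2.arcs.length by omega)
    (fun i hi => hall i (by omega))
  have e := (hrun m (by omega)).1
  rw [hfm] at e
  have e2 := congrArg Prod.snd e
  have hY := hr₁ f hf
  simp only at e2
  omega

/-- ★★★ **A SINGLY VISITED FIRST TURN FORCES A SLANTED END AT COST `5`.** Let `ω` be a wound class-`B2a` walk of limit cost `5` from the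
hole root, let `k` be its first non-straight arc (all earlier arcs straight), and suppose the plaquette of arc `k` is visited only once.
Then `ω` ends on the `N` or the `S` side of `r`: by `YBWalk.initial_run` that plaquette is `(w.1 + k, w.2)`, in the hole row, strictly
between the extreme rows `Y' < w.2 < Y`; singly visited and turning, it is an isolated turn (`isolated_turn`), and
`turn_profile_of_cost_five` bounds the isolated turns strictly between the extreme rows by the slot degree of the end side — so that
degree is `1`, a slanted side. [cite: GlazmanManolescu2019, §1, Fig. 1 and eq. (1); Lemma 2.1]
[cite: Glazman2015WeightedSAW, Lemma 3.1 (proof, pp. 6–7)] -/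
theorem end_slanted_of_first_turn_single_cost_five (hh : holeFaceW w ∉ D) (hr : RootedFace D (w.side .W) r) (h : ω.IsB2a)
    (hA : ω.AJ hr h (toC (midPt (w.side .W))) ≠ 0) (hc : cost (slotOfSide ω.1) ω.2.mids = 5) {k : ℕ}
    (hk : k < ω.2.arcs.length) (hstr : ∀ i < k, arcKind (ω.2.sIn i) (ω.2.sOut i) = .straight)
    (hks : arcKind (ω.2.sIn k) (ω.2.sOut k) ≠ .straight) (hsv : ∀ j < ω.2.arcs.length, ω.2.fc j = ω.2.fc k → j = k) :
    ω.1 = .N ∨ ω.1 = .S := by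
  classical
  obtain ⟨hrun, -⟩ := ω.2.initial_run hh hk hstr
  have hfck : ω.2.fc k = (w.1 + k, w.2) := (hrun k le_rfl).1
  have hP := isolated_turn hk hsv hks
  obtain ⟨Y, Y', hY'w, hYw, -, -, hprof, -⟩ := turn_profile_of_cost_five hh hr h hA hc
  have hmid := (hprof {ω.2.fc k} (fun f hf => by rw [Finset.mem_singleton.1 hf]; exact hP)).2.2
    (fun f hf => by rw [Finset.mem_singleton.1 hf, hfck]; exact ⟨by simpa using hY'w, by simpa using hYw⟩)
  rw [Finset.card_singleton] at hmid
  -- so the end slot has degree `1`: a slanted side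
  have key : ∀ u, ω.1 = u → 1 ≤ slotDeg (slotOfSide u) → u = .N ∨ u = .S := by
    intro u _ hd
    cases u
    · exact absurd hd (by decide)
    · exact absurd hd (by decide)
    · exact Or.inr rfl
    · exact Or.inl rfl
  exact key _ rfl hmid

/-- ★★★ **NO DOUBLE VISITS ⇒ SLANTED END AT COST `5`**: a wound class-`B2a` walk of limit cost `5` from the hole root whose plaquette map
`fc` is injective (no plaquette carries two arcs) ends on the `N` or the `S` side of its observed plaquette `r`.  This is the lane's
«slanted-end lemma» conditional on the absence of doubly visited plaquettes (exact census kit j276221: `n_{w₁} = n_{w₂} = 0` for every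
cost-`5` class-`B2a` member, and every such member has slot `N` or `S`). [cite: GlazmanManolescu2019, §1, Fig. 1 and eq. (1); Lemma 2.1,
Remark 2.2] [cite: Glazman2015WeightedSAW, Lemma 3.1 (proof, pp. 6–7)] -/
theorem end_slanted_of_injective_cost_five (hh : holeFaceW w ∉ D) (hr : RootedFace D (w.side .W) r) (h : ω.IsB2a)
    (hA : ω.AJ hr h (toC (midPt (w.side .W))) ≠ 0) (hc : cost (slotOfSide ω.1) ω.2.mids = 5)
    (hinj : ∀ i j, i < ω.2.arcs.length → j < ω.2.arcs.length → ω.2.fc i = ω.2.fc j → i = j) :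
    ω.1 = .N ∨ ω.1 = .S := by
  obtain ⟨k, hk, hstr, hks⟩ := exists_first_turn_of_wound hh hr h hA hc
  exact end_slanted_of_first_turn_single_cost_five hh hr h hA hc hk hstr hks (fun j hj he => hinj j k hj hk he)

end ΩG

end Literature.Probability.RandomPlanarGeometry.SAW.YangBaxter
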